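import Summits.ValiantsHypothesis.ValiantsHypothesis.Theorems.LacunarySymmetroidMatrixDescartesCensusV19GCheck

/-!
# `MatrixDescartes` census — splitting a `V19G.checkCells` slice into pieces (kernel memory budget)

HONEST FRAMING.  Object-search cell `pub-symmetroid`; door-A item `DoorA26 = PosRootLawAt 2 6 19` (stmt-ValiantsHypothesis-19979; OPEN, typed, never asserted).
Bookkeeping only (val-sym-door-p4 g6; the `V19G` twin of door-p4 g5's `…CensusV19SSplit`): `V19G.checkCells d (L₁ ++ L₂) (c₁ ++ c₂)` follows from the two
halves, so a `V19G` data file may replay a heavy slice of cells in several `decide +kernel` pieces (the kernel's memory budget is per declaration) and still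
state the slice in the shape `V19G.posRootLawOn_of_slices8` consumes.  Nothing here bears on `ζ_sym(2,6)`, on `DoorA26`, on `MatrixDescartes`
(stmt-ValiantsHypothesis-18050) or on `VP ≠ VNP`.

[folklore] Bookkeeping; elementary.
-/

-- the D-0017 layout repeats a namespace component (single-conjunct summit); the `dupNamespace` linter flags it; name mandated.
set_option linter.dupNamespace false

namespace Summit.ValiantsHypothesis.ValiantsHypothesis.Theorems.LacunarySymmetroidMatrixDescartes.Census.V19G

open V20 (Atom sortAtoms ordOK)
open V19S (Mode)

/-- `V19G.cellsOK` over concatenated lists of equal-length pieces. [folklore] -/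
theorem cellsOK_append (d : List ℕ) (ord : List Atom) :
    ∀ (M₁ : List (Bool × Mode)) (g₁ : List V19G.Cert) (M₂ : List (Bool × Mode)) (g₂ : List V19G.Cert), M₁.length = g₁.length →
      V19G.cellsOK d ord M₁ g₁ = true → V19G.cellsOK d ord M₂ g₂ = true → V19G.cellsOK d ord (M₁ ++ M₂) (g₁ ++ g₂) = true
  | [], [], M₂, g₂, _, _, h₂ => by simpa using h₂
  | [], _ :: _, _, _, h, _, _ => by simp at h
  | _ :: _, [], _, _, h, _, _ => by simp at h
  | (s, m) :: M₁, ct :: g₁, M₂, g₂, h, h₁, h₂ => by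
    simp only [cellsOK, Bool.and_eq_true] at h₁
    simp only [List.cons_append, cellsOK, Bool.and_eq_true]
    exact ⟨h₁.1, cellsOK_append d ord M₁ g₁ M₂ g₂ (by simpa using h) h₁.2 h₂⟩

/-- A `V19G.checkCells` slice from two pieces. [folklore] -/
theorem checkCells_of_halves {d : List ℕ} {M₁ M₂ M : List (Bool × Mode)} {g₁ g₂ g : List V19G.Cert}
    (h₁ : V19G.checkCells d M₁ g₁ = true) (h₂ : V19G.checkCells d M₂ g₂ = true) (hlen : M₁.length = g₁.length)
    (hM : M₁ ++ M₂ = M) (hg : g₁ ++ g₂ = g) : V19G.checkCells d M g = true := by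
  subst hM hg
  unfold checkCells at h₁ h₂ ⊢
  simp only [Bool.and_eq_true] at h₁ h₂ ⊢
  exact ⟨h₁.1, cellsOK_append d (sortAtoms d) M₁ g₁ M₂ g₂ hlen h₁.2 h₂.2⟩

end Summit.ValiantsHypothesis.ValiantsHypothesis.Theorems.LacunarySymmetroidMatrixDescartes.Census.V19G
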